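import Literature.IUT.HodgeArakelov.GaloisPairCyclotomesThetaSyncNonVacuity
import Literature.IUT.HodgeArakelov.GaloisPairCyclotomesThetaSyncOfBase
import Literature.IUT.HodgeArakelov.GaloisPairCyclotomesTwist
import Literature.IUT.HodgeArakelov.GaloisPairCyclotomesOrbitTorsor
import Literature.IUT.HodgeArakelov.GaloisPairCyclotomesGenuineRigidityUnits
import Literature.AnabelianGeometry.AbsoluteAnabelian.GaloisCyclotomeTransportNaturality
import HarnessLib

/-!
# [IUTchII] Cor. 1.11 — the functor `ℛ → ℱ` at GENUINE inputs (proof-only closer of the B12 chain)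

Mochizuki, *Inter-universal Teichmüller theory II*, §1, Corollary 1.11, kurims manuscript (Dec. 2020) p. 49 ll. 5–46:
(a) "the `Γ`-orbit (*bs-Gal_{G,⊳}) of the cyclotomic rigidity isomorphism `μ_Ẑ(G) ⥲ μ_Ẑ(O^×(G))` obtained by applying to the
MLF-Galois pair determined by `G ↷ O^⊳(G)` the algorithm … [AbsTopIII], Remark 3.2.1"; (b) "the `Aut(G)`-orbit (*bs-Gal_{G,Π}) of
isomorphisms `μ_Ẑ(G) ⥲ (l·Δ_Θ)(Π)` obtained by composing … `α : Π/Δ ⥲ G` … with the natural isomorphism `μ_Ẑ(G_k) ⥲ μ_Ẑ(Π_X)` of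
[AbsTopIII], Corollary 1.10, (c)"; (c) "the data … determines a functor `ℛ → ℱ` … In particular, the resulting natural functor
`Ψ_ℛ : ℛ → ℛ†` is multiradially defined" [claim: Mochizuki2012, status: disputed] (IUTchII §1 Cor 1.11, kurims p.49).
Record-only typing under the claim key `Mochizuki2012` (D-0012, disputed); abc-iut cell, layer L6, node `IUTchII:Cor1.11`
(W6-TRANCHE-1 row d001; coverage line = abc-iut-w6-d001), `plan/L6/MERGE-MAP.md` §8 row B12. Seat abc-iut-w4-d030 (gen 3).

THE CHAIN THIS FILE CLOSES (every link landed, consumed BY NAME, nothing restated; file split with abc-iut-w4-d024 g4 agreed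
06:46:01Z: orbit EXACTNESS = their `GaloisPairCyclotomesOrbitTorsor.lean` p428875, the genuine-inputs ∃-assembly = this file):
* interface `GaloisPairRigidityData` / `GalRigidityInput` / `GalThetaSyncInput` / `GalTwistInput` (abc-iut-L6-t1 p409065,
  abc-iut-w4-d024 p416294) and the functor of record `cor111FunctorCor110` over Cor. 1.10's family shape with its
  multiradiality `cor111FunctorCor110_multiradiallyDefined` (p417560, for ALL inputs);
* GENUINE twist `GalTwistInput.ofZHat` (the `Ẑ^×`-action on `μ_Ẑ(G)`, p417536);
* GENUINE monoids `AbsTopMonoids.genuineOfModel S (MLFClosure.std k) ε hΔ hq` (abc-iut-L6-t13 p421397: `O^⊳(G) = 𝒪_k̄^⊳`);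
* GENUINE rigidity input (a), NO residual hypothesis: this lineage's reduction
  `nonempty_galRigidityInput_genuineOfModel_of_muLift_natural` (p421900/p423689/p424836) fed with abc-iut-L6-t11's LCFT naturality
  `TorsionReciprocityData.exists_torsionReciprocityData_natural` (p425502) — the two-line composition whose NAMED form is
  abc-iut-L6-t11's closer `nonempty_galRigidityInput_genuineOfModel_holds` (`GaloisPairCyclotomesGenuineRigidityHolds.lean`, p427184;
  not imported here only to decouple this file from the build order — no declaration of it is restated, the composition is inlined
  inside the proofs);
* `Π`-side input (b): the CYCLOTOMIC pair `GalCorPiXInput.exists_cyclotomic` (p424107; genuine `μ_Ẑ(Π/Δ)` on the Galois side,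
  TAUTOLOGICAL on the `Θ`-side — labelled so) for the hypothesis-free form, and abc-iut-w4-d024's EXACT reduction
  `GalCorPiXInput.nonempty_family_of_base` (p424707) for Cor. 1.10's GENUINE base-datum families (`MonoThetaBaseDatum.family`,
  abc-iut-w4-d038 `EtaleLevels.familyLim`), whose ONE residual is the (E)+(C) datum at `Π₀` = [AbsTopIII] Cor. 1.10 (c) ∘
  «`Δ_Θ ≅ Ẑ(1)` as `Π`-modules» + [EtTh] Cor. 2.19 (i) (owner side FACT-LIST F-0348 / layer L2).

RESULTS (all `∃`-statements producing the inputs and then citing p417560's multiradiality):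
* `exists_cor111FunctorCor110_multiradiallyDefined_genuineOfModel` — at the genuine monoids of the standard closure of ANY
  non-archimedean local field `k` of characteristic `0`, with genuine twist and genuine rigidity input, the Cor. 1.11 functor EXISTS
  and is multiradially defined, for SOME Cor. 1.10-shaped family `D` whose `(l·Δ_Θ)(Π)` IS `μ_Ẑ(Π/Δ)` and some Cor. 1.10 (c) datum —
  NO hypothesis beyond the model identification `(ε, hΔ, hq)` of the genuine producer;
* `orbitA_orbitB_nonempty_genuineOfModel` — at the same inputs both printed orbits (a) `(*bs-Gal_{G,⊳})` and (b) `(*bs-Gal_{G,Π})`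
  are non-empty at every `(G)` / `(Π, G)`;
* `orbitA_exact_genuineOfModel` — and the orbit (a) is EXACT there: a `Γ`-torsor for every `Γ ⊆ Ẑ^×` and ALL isomorphisms
  `μ_Ẑ(G) ⥲ μ_Ẑ(O^×(G))` for `Γ = Ẑ^×` (Rmk. 1.11.1 (ii)) — abc-iut-w4-d024's `ofGaloisCyclotomeCor110_orbitA_top_eq_univ` /
  `…_existsUnique_of_mem_orbitA` (p428875, `Aut(μ_Ẑ(G_k)) = Ẑ^×` by LCFT) consumed BY NAME at the unconditional `R`;
* `exists_cor111FunctorCor110_family_multiradiallyDefined_of_base` — over Cor. 1.10's GENUINE base-datum family `X.family` at ANY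
  base point `Π₀` the same conclusion holds MODULO EXACTLY the typed (E)+(C) datum `c : μ_Ẑ(Π₀/Δ₀) ⥲ (l·Δ_Θ)(Π₀)` at `Π₀`;
* `EtaleLevels.exists_cor111FunctorCor110_familyLim_multiradiallyDefined_of_base` — the previous item AT abc-iut-w4-d038's genuine
  natural system `familyLim` over the [EtTh]-model setting `EtaleLevels.setting` (universe `0`, so the genuine producer applies):
  [IUTchII] Cor. 1.11's functor with ALL FOUR inputs genuine, the single residual being the (E)+(C) datum BY NAME.

HONEST FRAMING: bookkeeping over the cell's typed interfaces; no definition, no named `Prop` fact, nothing of another seat edited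
or restated; «inputs inhabited» ≠ «endorsed»; the `Ism`-side of `genuineOfModel` is the degenerate one declared by its producer
(B9 (d) residual, abc-iut-L6-d2); nothing here bears on [IUTchIII] Cor. 3.12 and no side is taken; typed ≠ discharged.
-/

noncomputable section

namespace Literature.IUT.HodgeArakelov

open CategoryTheory Literature.AnabelianGeometry.AbsoluteAnabelian

namespace AbsTopMonoids.Genuine

variable (k : Type) [Field k] [CharZero k] [ValuativeRel k] [TopologicalSpace k] [IsNonarchimedeanLocalField k]
  {S : ThetaSetting.{0}} [CompactSpace S.Gk]
  (ε : S.Gk ≃ₜ* (ModelMLFGaloisData.galois (MLFClosure.std k).k (MLFClosure.std k).K).tmPair.Pi)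
  (hΔ : ∀ f : S.PiX ≃ₜ* S.PiX, S.DeltaX.map f.toMulEquiv.toMonoidHom = S.DeltaX)
  (hq : Nonempty (TopGroup.quot S.PiX S.DeltaX ≃ₜ* S.Gk))

/-- **[IUTchII] Cor. 1.11 at the GENUINE monoids with GENUINE twist and GENUINE rigidity input — hypothesis-free.** For the
genuine `AbsTopMonoids` of the standard closure of a non-archimedean local field `k` (abc-iut-L6-t13's `genuineOfModel`), there
are a rigidity input `R` (INHABITED unconditionally: abc-iut-L6-t11's `nonempty_galRigidityInput_genuineOfModel_holds`), a
Cor. 1.10-shaped family `D` whose `(l·Δ_Θ)(Π)` is the genuine `μ_Ẑ(Π/Δ)` ON THE NOSE, and a Cor. 1.10 (c) datum `C` (the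
cyclotomic pair — genuine Galois side, tautological `Θ`-side) such that the functor `ℛ → ℱ` of record with the genuine
`Ẑ^×`-twist is multiradially defined. [claim: Mochizuki2012, status: disputed] (IUTchII §1 Cor 1.11, kurims p.49) -/
theorem exists_cor111FunctorCor110_multiradiallyDefined_genuineOfModel (Γ : Subgroup ZHatUnits) (Γ' : Type) [Group Γ'] :
    ∃ (R : GalRigidityInput (AbsTopMonoids.genuineOfModel S (MLFClosure.std k) ε hΔ hq))
      (D : MonoThetaRigidityData S)
      (C : GalCorPiXInput (AbsTopMonoids.genuineOfModel S (MLFClosure.std k) ε hΔ hq) D),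
      (∀ P : IsoClass S.PiX,
          (D.intCyc P : Type) = ↥((AbsTopMonoids.genuineOfModel S (MLFClosure.std k) ε hΔ hq).quotObj P).galCyclotome) ∧
        ((ex18iii S Γ').toDagger
          (cor111FunctorCor110 (GalTwistInput.ofZHat S) R D C Γ Γ')).IsMultiradiallyDefined := by
  obtain ⟨Dk, hDk⟩ := TorsionReciprocityData.exists_torsionReciprocityData_natural k
  obtain ⟨R⟩ := nonempty_galRigidityInput_genuineOfModel_of_muLift_natural k ε hΔ hq Dk
    fun φ ψ hψ hU => (hDk φ ψ hψ hU).1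
  obtain ⟨D, ⟨C⟩, hD⟩ := GalCorPiXInput.exists_cyclotomic (AbsTopMonoids.genuineOfModel S (MLFClosure.std k) ε hΔ hq)
  exact ⟨R, D, C, hD, cor111FunctorCor110_multiradiallyDefined (GalTwistInput.ofZHat S) R D C Γ Γ'⟩

/-- **Both printed orbits are non-empty at the genuine inputs** ([IUTchII] Cor. 1.11 (a) `(*bs-Gal_{G,⊳})`, (b)
`(*bs-Gal_{G,Π})`): for the B12 instance over the genuine monoids, genuine twist, the unconditional rigidity input and the
cyclotomic `Π`-pair, the orbit (a) is non-empty for every closed subgroup `Γ ⊆ Ẑ^×` at every `G`, and the orbit (b) at every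
`(Π, G)`. [claim: Mochizuki2012, status: disputed] (IUTchII §1 Cor 1.11, kurims p.49) -/
theorem orbitA_orbitB_nonempty_genuineOfModel :
    ∃ (R : GalRigidityInput (AbsTopMonoids.genuineOfModel S (MLFClosure.std k) ε hΔ hq))
      (D : MonoThetaRigidityData S)
      (C : GalCorPiXInput (AbsTopMonoids.genuineOfModel S (MLFClosure.std k) ε hΔ hq) D),
      (∀ (Γ : Subgroup ZHatUnits) (G : IsoClass S.Gk),
          ((GaloisPairRigidityData.ofGaloisCyclotomeCor110 (GalTwistInput.ofZHat S) R D C).orbitA Γ G).Nonempty) ∧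
        ∀ (P : IsoClass S.PiX) (G : IsoClass S.Gk),
          ((GaloisPairRigidityData.ofGaloisCyclotomeCor110 (GalTwistInput.ofZHat S) R D C).orbitB P G).Nonempty := by
  obtain ⟨Dk, hDk⟩ := TorsionReciprocityData.exists_torsionReciprocityData_natural k
  obtain ⟨R⟩ := nonempty_galRigidityInput_genuineOfModel_of_muLift_natural k ε hΔ hq Dk
    fun φ ψ hψ hU => (hDk φ ψ hψ hU).1
  obtain ⟨D, ⟨C⟩, -⟩ := GalCorPiXInput.exists_cyclotomic (AbsTopMonoids.genuineOfModel S (MLFClosure.std k) ε hΔ hq)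
  exact ⟨R, D, C, fun Γ G => ofGaloisCyclotome_orbitA_nonempty _ R _ Γ G,
    fun P G => ofGaloisCyclotome_orbitB_nonempty _ R _ P G⟩

/-- **The orbit (a) is EXACT at the genuine inputs** ([IUTchII] Cor. 1.11 (a) + Rmk. 1.11.1 (ii) "allowing for a
`Γ (= Ẑ^×)`-multiple indeterminacy", kurims p. 50): for the B12 instance over the genuine monoids, genuine twist and the
unconditional rigidity input, (i) for `Γ = Ẑ^×` the orbit `(*bs-Gal_{G,⊳})` is the set of ALL group isomorphisms
`μ_Ẑ(G) ⥲ μ_Ẑ(O^×(G))`, and (ii) for every `Γ` each member is `χ(γ) ≫ (*bs-Gal)` for EXACTLY ONE `γ ∈ Γ` — abc-iut-w4-d024's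
`ofGaloisCyclotomeCor110_orbitA_top_eq_univ` / `ofGaloisCyclotomeCor110_existsUnique_of_mem_orbitA` (p428875: `Aut(μ_Ẑ(G_k)) = Ẑ^×`
by local class field theory) at `R` from abc-iut-L6-t11's p427184; abc-iut-L6-t13's model identification `ε` IS an
identification with `Gal(k̄/k)` (definitionally). [claim: Mochizuki2012, status: disputed] (IUTchII §1 Cor 1.11, kurims p.49) -/
theorem orbitA_exact_genuineOfModel :
    ∃ (R : GalRigidityInput (AbsTopMonoids.genuineOfModel S (MLFClosure.std k) ε hΔ hq))
      (D : MonoThetaRigidityData S)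
      (C : GalCorPiXInput (AbsTopMonoids.genuineOfModel S (MLFClosure.std k) ε hΔ hq) D),
      (∀ G : IsoClass S.Gk,
          (GaloisPairRigidityData.ofGaloisCyclotomeCor110 (GalTwistInput.ofZHat S) R D C).orbitA ⊤ G = Set.univ) ∧
        ∀ (Γ : Subgroup ZHatUnits) (G : IsoClass S.Gk)
          (φ : G.galCyclotome ≃* (AbsTopMonoids.genuineOfModel S (MLFClosure.std k) ε hΔ hq).muZhatUnits G),
          φ ∈ (GaloisPairRigidityData.ofGaloisCyclotomeCor110 (GalTwistInput.ofZHat S) R D C).orbitA Γ G →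
            ∃! γ : ZHatUnits, γ ∈ Γ ∧ φ = (G.galCyclotomeTwist γ).trans (R.bsGalTri G) := by
  obtain ⟨Dk, hDk⟩ := TorsionReciprocityData.exists_torsionReciprocityData_natural k
  obtain ⟨R⟩ := nonempty_galRigidityInput_genuineOfModel_of_muLift_natural k ε hΔ hq Dk
    fun φ ψ hψ hU => (hDk φ ψ hψ hU).1
  obtain ⟨D, ⟨C⟩, -⟩ := GalCorPiXInput.exists_cyclotomic (AbsTopMonoids.genuineOfModel S (MLFClosure.std k) ε hΔ hq)
  exact ⟨R, D, C,
    fun G => GaloisPairRigidityData.ofGaloisCyclotomeCor110_orbitA_top_eq_univ k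
      (ε : S.Gk ≃ₜ* Field.absoluteGaloisGroup k) R D C G,
    fun Γ G _ hφ => GaloisPairRigidityData.ofGaloisCyclotomeCor110_existsUnique_of_mem_orbitA k
      (ε : S.Gk ≃ₜ* Field.absoluteGaloisGroup k) R D C Γ G hφ⟩

/-- **[IUTchII] Cor. 1.11 over Cor. 1.10's GENUINE base-datum family, modulo EXACTLY the (E)+(C) datum at `Π₀`.** For a
base datum `X` at any `Π₀` (constant modules `(l·Δ_Θ)(Π₀)`, transport `ρ_A`; abc-iut-w4-d038 / w5-d145) and ONE isomorphism
`c : μ_Ẑ(Π₀/Δ₀) ⥲ (l·Δ_Θ)(Π₀)` that is (E) `Π₀`-equivariant and (C) compatible with every topological automorphism of `Π₀`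
([AbsTopIII] Cor. 1.10 (c) ∘ «`Δ_Θ ≅ Ẑ(1)` as `Π`-modules» + [EtTh] Cor. 2.19 (i) — the named residual of abc-iut-w4-d024's
`GalCorPiXInput.nonempty_family_of_base`), the Cor. 1.11 functor over `X.family` at the genuine monoids / twist / rigidity input
EXISTS and is multiradially defined. [claim: Mochizuki2012, status: disputed] (IUTchII §1 Cor 1.11, kurims p.49) -/
theorem exists_cor111FunctorCor110_family_multiradiallyDefined_of_base {P₀ : IsoClass S.PiX} (X : MonoThetaBaseDatum S P₀)
    (c : ↥((AbsTopMonoids.genuineOfModel S (MLFClosure.std k) ε hΔ hq).quotObj P₀).galCyclotome ≃* X.A)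
    (hE : ∀ (x : P₀.G) (ζ : ((AbsTopMonoids.genuineOfModel S (MLFClosure.std k) ε hΔ hq).quotObj P₀).galCyclotome),
      c (haveI := ((AbsTopMonoids.genuineOfModel S (MLFClosure.std k) ε hΔ hq).quotObj P₀).compactSpace_carrier;
          (QuotientGroup.mk x : P₀.G ⧸ (AbsTopMonoids.genuineOfModel S (MLFClosure.std k) ε hΔ hq).Delta P₀) • ζ) =
        X.actA x (c ζ))
    (hC : ∀ (γ : P₀ ⟶ P₀) (ζ : ((AbsTopMonoids.genuineOfModel S (MLFClosure.std k) ε hΔ hq).quotObj P₀).galCyclotome),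
      c (IsoClass.galCyclotomeMap ((AbsTopMonoids.genuineOfModel S (MLFClosure.std k) ε hΔ hq).quotMap γ) ζ) =
        X.rhoA (IsoClass.homIso γ) (c ζ))
    (Γ : Subgroup ZHatUnits) (Γ' : Type) [Group Γ'] :
    ∃ (R : GalRigidityInput (AbsTopMonoids.genuineOfModel S (MLFClosure.std k) ε hΔ hq))
      (C : GalCorPiXInput (AbsTopMonoids.genuineOfModel S (MLFClosure.std k) ε hΔ hq) X.family),
      ((ex18iii S Γ').toDagger
        (cor111FunctorCor110 (GalTwistInput.ofZHat S) R X.family C Γ Γ')).IsMultiradiallyDefined := by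
  obtain ⟨Dk, hDk⟩ := TorsionReciprocityData.exists_torsionReciprocityData_natural k
  obtain ⟨R⟩ := nonempty_galRigidityInput_genuineOfModel_of_muLift_natural k ε hΔ hq Dk
    fun φ ψ hψ hU => (hDk φ ψ hψ hU).1
  obtain ⟨C⟩ := GalCorPiXInput.nonempty_family_of_base _ X c hE hC
  exact ⟨R, C, cor111FunctorCor110_multiradiallyDefined (GalTwistInput.ofZHat S) R X.family C Γ Γ'⟩

end AbsTopMonoids.Genuine

/-! ## At abc-iut-w4-d038's genuine natural system `familyLim` over the [EtTh]-model setting -/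

namespace EtaleLevels

open Literature.AnabelianGeometry.EtaleTheta Literature.AnabelianGeometry.SemiGraphs
open scoped Literature.AnabelianGeometry.EtaleTheta

variable {p : ℕ} [Fact p.Prime] {D : Literature.AnabelianGeometry.EtaleTheta.ThetaSetting p}
  {E : D.EtaleThetaData} {l : ℕ} (C : E.DoubleUnderline l) (hC : D.Compat) (hS : D.Sec2Hyps)
  (hl : l.Prime) (hp2 : p ≠ 2) (hpl : p ≠ l) (hζ : ∃ ζ : D.K, IsPrimitiveRoot ζ (4 * l))
  (mods : ∀ M : ℕ+, D.CyclotomeMod l M)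
  (f : contCocycles D.toTheta D.DeltaTheta C.GtpYdduu) (hf : f ∈ C.rootCocycles hC)
  (hmods : ∀ (M M' : ℕ+) (h : (M : ℕ) ∣ (M' : ℕ)) (x : D.lDeltaTheta l),
    MuN.red p M M' h ((mods M').red x) = (mods M).red x)
  (h15 : Literature.AnabelianGeometry.EtaleTheta.ThetaSetting.Prop15iii E hC) (L : C.CuspLabels)
  (hZ : ∀ M : ℕ+, Nonempty (ModelCyclotomes.lDeltaQuot (C.rigidData (mods M) hC hS h15 L) ≃*
    Literature.IUT.HodgeTheaters.ZHat))
  (h218i₁ : (levelRigid C hC hS mods h15 L 1).Cor218_i)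
  (k : Type) [Field k] [CharZero k] [ValuativeRel k] [TopologicalSpace k] [IsNonarchimedeanLocalField k]
  [CompactSpace (setting C hC hS hl hp2 hpl hζ mods f hf).Gk]
  (ε : (setting C hC hS hl hp2 hpl hζ mods f hf).Gk ≃ₜ*
    (ModelMLFGaloisData.galois (MLFClosure.std k).k (MLFClosure.std k).K).tmPair.Pi)
  (hΔ : ∀ g : (setting C hC hS hl hp2 hpl hζ mods f hf).PiX ≃ₜ* (setting C hC hS hl hp2 hpl hζ mods f hf).PiX,
    (setting C hC hS hl hp2 hpl hζ mods f hf).DeltaX.map g.toMulEquiv.toMonoidHom =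
      (setting C hC hS hl hp2 hpl hζ mods f hf).DeltaX)
  (hq : Nonempty (TopGroup.quot (setting C hC hS hl hp2 hpl hζ mods f hf).PiX
    (setting C hC hS hl hp2 hpl hζ mods f hf).DeltaX ≃ₜ* (setting C hC hS hl hp2 hpl hζ mods f hf).Gk))

/-- **[IUTchII] Cor. 1.11 with ALL FOUR inputs GENUINE, modulo ONE named datum.** Over the [EtTh]-model setting
`EtaleLevels.setting` (level `1` of the natural system; universe `0`, so abc-iut-L6-t13's genuine producer applies along a model
identification `ε` of its `G_k` with the absolute Galois group of the standard closure of `k`): with the GENUINE monoids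
`genuineOfModel`, the GENUINE `Ẑ^×`-twist, the UNCONDITIONAL rigidity input (a) (abc-iut-L6-t11 p427184) and Cor. 1.10's
GENUINE functorial family `familyLim` (abc-iut-w4-d038: `(l·Δ_Θ)(𝕄_*)`, `ρ_A = rhoALim`, [EtTh] Cor. 2.18 (i) at level `1` BY
NAME), the Cor. 1.11 functor `ℛ → ℱ` EXISTS and is multiradially defined GIVEN EXACTLY the (E)+(C) datum
`c : μ_Ẑ(Π^tp_{X̲̲}/Δ) ⥲ (l·Δ_Θ)(𝕄_*)` of `EtaleLevels.nonempty_galCorPiXInput_familyLim_iff` (abc-iut-w4-d024 p424707) —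
[AbsTopIII] Cor. 1.10 (c) ∘ «`Δ_Θ ≅ Ẑ(1)` as `Π`-modules» + [EtTh] Cor. 2.19 (i), not constructed here.
[claim: Mochizuki2012, status: disputed] (IUTchII §1 Cor 1.11, kurims p.49) -/
theorem exists_cor111FunctorCor110_familyLim_multiradiallyDefined_of_base
    (c : ↥((AbsTopMonoids.genuineOfModel (setting C hC hS hl hp2 hpl hζ mods f hf) (MLFClosure.std k) ε hΔ hq).quotObj
          (basePointLim C hC hS hl hp2 hpl hζ mods f hf hmods h15 L hZ)).galCyclotome ≃*
        (baseDatumLim C hC hS hl hp2 hpl hζ mods f hf hmods h15 L hZ h218i₁).A)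
    (hE : ∀ (x : (basePointLim C hC hS hl hp2 hpl hζ mods f hf hmods h15 L hZ).G)
        (ζ : ((AbsTopMonoids.genuineOfModel (setting C hC hS hl hp2 hpl hζ mods f hf) (MLFClosure.std k) ε hΔ hq).quotObj
          (basePointLim C hC hS hl hp2 hpl hζ mods f hf hmods h15 L hZ)).galCyclotome),
      c (haveI := ((AbsTopMonoids.genuineOfModel (setting C hC hS hl hp2 hpl hζ mods f hf) (MLFClosure.std k) ε hΔ
            hq).quotObj (basePointLim C hC hS hl hp2 hpl hζ mods f hf hmods h15 L hZ)).compactSpace_carrier;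
          (QuotientGroup.mk x : _ ⧸ (AbsTopMonoids.genuineOfModel (setting C hC hS hl hp2 hpl hζ mods f hf)
            (MLFClosure.std k) ε hΔ hq).Delta _) • ζ) =
        (baseDatumLim C hC hS hl hp2 hpl hζ mods f hf hmods h15 L hZ h218i₁).actA x (c ζ))
    (hC' : ∀ (γ : basePointLim C hC hS hl hp2 hpl hζ mods f hf hmods h15 L hZ ⟶
          basePointLim C hC hS hl hp2 hpl hζ mods f hf hmods h15 L hZ)
        (ζ : ((AbsTopMonoids.genuineOfModel (setting C hC hS hl hp2 hpl hζ mods f hf) (MLFClosure.std k) ε hΔ hq).quotObj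
          (basePointLim C hC hS hl hp2 hpl hζ mods f hf hmods h15 L hZ)).galCyclotome),
      c (IsoClass.galCyclotomeMap
          ((AbsTopMonoids.genuineOfModel (setting C hC hS hl hp2 hpl hζ mods f hf) (MLFClosure.std k) ε hΔ hq).quotMap γ) ζ) =
        (baseDatumLim C hC hS hl hp2 hpl hζ mods f hf hmods h15 L hZ h218i₁).rhoA (IsoClass.homIso γ) (c ζ))
    (Γ : Subgroup ZHatUnits) (Γ' : Type) [Group Γ'] :
    ∃ (R : GalRigidityInput
        (AbsTopMonoids.genuineOfModel (setting C hC hS hl hp2 hpl hζ mods f hf) (MLFClosure.std k) ε hΔ hq))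
      (I : GalCorPiXInput
        (AbsTopMonoids.genuineOfModel (setting C hC hS hl hp2 hpl hζ mods f hf) (MLFClosure.std k) ε hΔ hq)
        (familyLim C hC hS hl hp2 hpl hζ mods f hf hmods h15 L hZ h218i₁)),
      ((ex18iii (setting C hC hS hl hp2 hpl hζ mods f hf) Γ').toDagger
        (cor111FunctorCor110 (GalTwistInput.ofZHat (setting C hC hS hl hp2 hpl hζ mods f hf)) R
          (familyLim C hC hS hl hp2 hpl hζ mods f hf hmods h15 L hZ h218i₁) I Γ Γ')).IsMultiradiallyDefined :=
  AbsTopMonoids.Genuine.exists_cor111FunctorCor110_family_multiradiallyDefined_of_base k ε hΔ hq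
    (baseDatumLim C hC hS hl hp2 hpl hζ mods f hf hmods h15 L hZ h218i₁) c hE hC' Γ Γ'

end EtaleLevels

end Literature.IUT.HodgeArakelov

end
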